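import Literature.Dynamics.SymbolicDynamics.StrongIrreducibility
import Mathlib.Logic.Relation
import HarnessLib

/-!
# Hochman 2025, §6.1: reduction of strong irreducibility to gluing into the OUTER far region

M. Hochman, *Irreducibility and periodicity in `ℤ²` symbolic systems* (Discrete Analysis
2025:17), §6.1 reduces strong irreducibility with gap `g` (property (A): gluing along all pairs
`E, F ⊆ ℤ²` with `d(E, F) > g`) to property (E): gluing along pairs `(E, F)` with `F` finite and
(simply) connected and `E` *the unbounded component* of `{u | d(u, F) > ½g - 2}` — so that nothing
is required of the glued configuration in the holes of `F`. The reductions (B) ⇒ (C) ⇒ (D) ⇒ (E)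
there are inductions over connected components ordered by "`J'` separates `J` from infinity",
phrased with planar topology.

This file proves a topology-free version of that reduction for the sup-metric of `ℤ × ℤ`
(`isFinitelyStronglyIrreducible_of_outer`): if `X` admits gluing of `y|_J` into `x` on the
*outer far region* `Outer g J` for every finite non-empty `g`-chain-connected `J`, then `X` is
strongly irreducible with gap `g` along finite sets (property (B), the tree's
`IsFinitelyStronglyIrreducible`). Here

* `Far g J = {u | ∀ q ∈ J, g < d(u, q)}` is the whole far region;
* a site *escapes* (`Escapes g J u`) if it lies more than `g` to the left of every site of `J`;
* `Outer g J` is the set of sites joined to an escaping site by a `g`-chain inside `Far g J`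
  (steps of length `≤ g`); it replaces "the unbounded component".

The induction (Hochman's (C) ⇒ (D), p. 27: "Let `J` be a connected component of `E ∪ F` that is
minimal ... all other components of `E ∪ F` are contained in the unbounded component `J'`") runs
over the `g`-chain-component `Jₘ` of `E ∪ F` of **minimal sup-diameter**: every other component
`K` lies in `Far g Jₘ`, is `g`-chain-connected there, and if it missed `Outer g Jₘ` then none of
its sites could escape, which forces `K` strictly inside the bounding box of `Jₘ`
(`Hochman2025.mem_outer_of_not_inside`: from a far site on or beyond a side of the bounding
box one walks away from `J` monotonically, then around to the left), hence
`diam K ≤ diam Jₘ - 2`, contradicting minimality. Gluing `Jₘ` last (into the gluing of the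
remaining components obtained from the induction hypothesis, with the roles of `x` and `y`
swapped when `Jₘ ⊆ E`) then glues everything.

## Main statements

* `Hochman2025.ldist`, `Hochman2025.Far`, `Hochman2025.Escapes`, `Hochman2025.Outer`,
  `Hochman2025.ldiam` and their API (`mem_outer_of_not_inside`, `inside_of_not_mem_outer`,
  `finite_compl_outer`, `ldiam_add_two_le`).
* `isFinitelyStronglyIrreducible_of_outer` — the reduction (B) ⇐ (E′).

## References

* [Hochman2025] M. Hochman, *Irreducibility and periodicity in `ℤ²` symbolic systems*, Discrete
  Analysis 2025:17, §6.1 (pp. 25–28). Read via `lit read arxiv:2401.02273`.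
-/

open Set

namespace Literature.Dynamics.SymbolicDynamics

namespace Hochman2025

/-! ### The sup-distance on `ℤ²` as a natural number -/

/-- The sup-distance on `ℤ²`, as a natural number. [folklore] -/
def ldist (u v : ℤ × ℤ) : ℕ := max (u.1 - v.1).natAbs (u.2 - v.2).natAbs

/-- `ldist` is the metric of `ℤ × ℤ`. [folklore] -/
theorem dist_eq_ldist (u v : ℤ × ℤ) : dist u v = (ldist u v : ℝ) := by
  rw [Prod.dist_eq, Int.dist_eq, Int.dist_eq, ldist]
  have h1 : (((u.1 - v.1).natAbs : ℕ) : ℝ) = |((u.1 : ℝ) - v.1)| := by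
    rw [Nat.cast_natAbs]; push_cast; rfl
  have h2 : (((u.2 - v.2).natAbs : ℕ) : ℝ) = |((u.2 : ℝ) - v.2)| := by
    rw [Nat.cast_natAbs]; push_cast; rfl
  push_cast
  rw [h1, h2]

/-- `ldist` is symmetric. [folklore] -/
theorem ldist_comm (u v : ℤ × ℤ) : ldist u v = ldist v u := by
  have := dist_eq_ldist u v
  rw [dist_comm, dist_eq_ldist] at this
  exact_mod_cast this.symm

/-- Triangle inequality for `ldist`. [folklore] -/
theorem ldist_triangle (u v w : ℤ × ℤ) : ldist u w ≤ ldist u v + ldist v w := by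
  have := dist_triangle u v w
  rw [dist_eq_ldist, dist_eq_ldist, dist_eq_ldist] at this
  exact_mod_cast this

/-- `ldist u u = 0`. [folklore] -/
@[simp] theorem ldist_self (u : ℤ × ℤ) : ldist u u = 0 := by simp [ldist]

/-- Coordinate bounds from `ldist`. [folklore] -/
theorem abs_sub_le_ldist (u v : ℤ × ℤ) :
    |u.1 - v.1| ≤ ldist u v ∧ |u.2 - v.2| ≤ ldist u v := by
  constructor
  · rw [← Int.natCast_natAbs]; exact_mod_cast le_max_left _ _
  · rw [← Int.natCast_natAbs]; exact_mod_cast le_max_right _ _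

/-- `ldist` from coordinate bounds. [folklore] -/
theorem ldist_le_iff (u v : ℤ × ℤ) (n : ℕ) :
    ldist u v ≤ n ↔ |u.1 - v.1| ≤ n ∧ |u.2 - v.2| ≤ n := by
  simp only [ldist, max_le_iff]
  rw [← Int.ofNat_le, ← Int.ofNat_le, Int.natCast_natAbs, Int.natCast_natAbs]

/-- A lower bound on one coordinate difference bounds `ldist` below. [folklore] -/
theorem le_ldist_of_le_fst {u v : ℤ × ℤ} {n : ℕ} (h : (n : ℤ) ≤ |u.1 - v.1|) : n ≤ ldist u v := by
  have := (abs_sub_le_ldist u v).1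
  exact_mod_cast le_trans h this

/-- A lower bound on the other coordinate difference bounds `ldist` below. [folklore] -/
theorem le_ldist_of_le_snd {u v : ℤ × ℤ} {n : ℕ} (h : (n : ℤ) ≤ |u.2 - v.2|) : n ≤ ldist u v := by
  have := (abs_sub_le_ldist u v).2
  exact_mod_cast le_trans h this

/-- `g < dist u v ↔ g < ldist u v` for natural `g`. [folklore] -/
theorem lt_dist_iff (g : ℕ) (u v : ℤ × ℤ) : (g : ℝ) < dist u v ↔ g < ldist u v := by
  rw [dist_eq_ldist]; exact_mod_cast Iff.rfl

/-- `dist u v ≤ g ↔ ldist u v ≤ g` for natural `g`. [folklore] -/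
theorem dist_le_iff (g : ℕ) (u v : ℤ × ℤ) : dist u v ≤ (g : ℝ) ↔ ldist u v ≤ g := by
  rw [dist_eq_ldist]; exact_mod_cast Iff.rfl

/-! ### The far region, escaping sites, the outer far region -/

variable (g : ℕ) (J : Finset (ℤ × ℤ))

/-- **The far region** `{u | d(u, J) > g}` of a finite set (Hochman's `E_x`, §6.2).
[cite: Hochman2025, §6.1–6.2] -/
def Far : Set (ℤ × ℤ) := {u | ∀ q ∈ J, (g : ℝ) < dist u q}

/-- A site *escapes* `J` if it lies more than `g` to the left of every site of `J` (such sites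
play the role of "infinity"). [cite: Hochman2025, §6.1 (the unbounded component)] -/
def Escapes (u : ℤ × ℤ) : Prop := ∀ q ∈ J, u.1 + g < q.1

/-- The `g`-chain relation inside a set `S`: both sites in `S`, at distance `≤ g`.
[cite: Hochman2025, §6.1] -/
def ChainRel (S : Set (ℤ × ℤ)) (a b : ℤ × ℤ) : Prop := a ∈ S ∧ b ∈ S ∧ dist a b ≤ (g : ℝ)

/-- **The outer far region**: far sites joined to an escaping site by a `g`-chain of far sites.
This is the topology-free stand-in for "the unbounded component of `{u | d(u, F) > ½g - 2}`" of
Hochman's property (E). [cite: Hochman2025, §6.1 (E)] -/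
def Outer : Set (ℤ × ℤ) :=
  {u | ∃ u', Escapes g J u' ∧ Relation.ReflTransGen (ChainRel g (Far g J)) u u'}

variable {g J}

/-- Membership in `Far` via `ldist`. [folklore] -/
theorem mem_far_iff {u : ℤ × ℤ} : u ∈ Far g J ↔ ∀ q ∈ J, g < ldist u q := by
  simp only [Far, mem_setOf_eq, lt_dist_iff]

/-- Escaping sites are far. [folklore] -/
theorem Escapes.mem_far {u : ℤ × ℤ} (h : Escapes g J u) : u ∈ Far g J := by
  rw [mem_far_iff]
  intro q hq
  have h1 := h q hq
  apply le_ldist_of_le_fst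
  rw [abs_sub_comm, abs_of_nonneg (by omega)]
  push_cast
  omega

/-- The chain relation is symmetric, hence so are its chains. [folklore] -/
theorem chainRel_reflTransGen_symm {S : Set (ℤ × ℤ)} {a b : ℤ × ℤ}
    (h : Relation.ReflTransGen (ChainRel g S) a b) : Relation.ReflTransGen (ChainRel g S) b a := by
  induction h with
  | refl => exact Relation.ReflTransGen.refl
  | tail _ hbc ih =>
    exact Relation.ReflTransGen.head ⟨hbc.2.1, hbc.1, by rw [dist_comm]; exact hbc.2.2⟩ ih

/-- A non-trivial chain starts inside the set. [folklore] -/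
theorem mem_of_reflTransGen {S : Set (ℤ × ℤ)} {a b : ℤ × ℤ}
    (h : Relation.ReflTransGen (ChainRel g S) a b) (hb : b ∈ S) : a ∈ S := by
  induction h with
  | refl => exact hb
  | tail _ hbc ih => exact ih hbc.1

/-- Chains inside a smaller set are chains inside a larger one. [folklore] -/
theorem reflTransGen_mono {S S' : Set (ℤ × ℤ)} (hSS' : S ⊆ S') {a b : ℤ × ℤ}
    (h : Relation.ReflTransGen (ChainRel g S) a b) : Relation.ReflTransGen (ChainRel g S') a b := by
  induction h with
  | refl => exact Relation.ReflTransGen.refl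
  | tail _ hbc ih => exact ih.tail ⟨hSS' hbc.1, hSS' hbc.2.1, hbc.2.2⟩

/-- `Outer ⊆ Far`. [cite: Hochman2025, §6.1] -/
theorem outer_subset_far : Outer g J ⊆ Far g J := by
  rintro u ⟨u', hu', hch⟩
  exact mem_of_reflTransGen hch hu'.mem_far

/-- A far site chained (through far sites) to an outer site is outer. [folklore] -/
theorem mem_outer_of_reflTransGen {u v : ℤ × ℤ}
    (h : Relation.ReflTransGen (ChainRel g (Far g J)) u v) (hv : v ∈ Outer g J) : u ∈ Outer g J := by
  obtain ⟨u', hu', hch⟩ := hv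
  exact ⟨u', hu', h.trans hch⟩

/-- An escaping site is outer. [folklore] -/
theorem Escapes.mem_outer {u : ℤ × ℤ} (h : Escapes g J u) : u ∈ Outer g J :=
  ⟨u, h, Relation.ReflTransGen.refl⟩

/-! ### Walking inside the far region -/

/-- A horizontal unit-step walk all of whose sites are far is a chain in `Far` (`g ≥ 1`).
[folklore] -/
theorem reflTransGen_walk_fst (hg : 1 ≤ g) (u : ℤ × ℤ) (s : ℤ) (hs : s = 1 ∨ s = -1) (K : ℕ)
    (h : ∀ k : ℕ, k ≤ K → (u.1 + k * s, u.2) ∈ Far g J) :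
    Relation.ReflTransGen (ChainRel g (Far g J)) u (u.1 + K * s, u.2) := by
  induction K with
  | zero => simpa using Relation.ReflTransGen.refl
  | succ K ih =>
    have ih' := ih fun k hk => h k (Nat.le_succ_of_le hk)
    refine Relation.ReflTransGen.tail ih' ⟨h K (Nat.le_succ K), h (K + 1) le_rfl, ?_⟩
    rw [dist_le_iff, ldist_le_iff]
    constructor
    · push_cast
      rcases hs with rfl | rfl <;> simp <;> omega
    · simp

/-- A vertical unit-step walk all of whose sites are far is a chain in `Far` (`g ≥ 1`).
[folklore] -/
theorem reflTransGen_walk_snd (hg : 1 ≤ g) (u : ℤ × ℤ) (s : ℤ) (hs : s = 1 ∨ s = -1) (K : ℕ)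
    (h : ∀ k : ℕ, k ≤ K → (u.1, u.2 + k * s) ∈ Far g J) :
    Relation.ReflTransGen (ChainRel g (Far g J)) u (u.1, u.2 + K * s) := by
  induction K with
  | zero => simpa using Relation.ReflTransGen.refl
  | succ K ih =>
    have ih' := ih fun k hk => h k (Nat.le_succ_of_le hk)
    refine Relation.ReflTransGen.tail ih' ⟨h K (Nat.le_succ K), h (K + 1) le_rfl, ?_⟩
    rw [dist_le_iff, ldist_le_iff]
    constructor
    · simp
    · push_cast
      rcases hs with rfl | rfl <;> simp <;> omega

/-- A whole column more than `g` to the left or right of `J` is far. [folklore] -/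
theorem mem_far_of_fst {X : ℤ} (hX : ∀ q ∈ J, (g : ℤ) < |X - q.1|) (y : ℤ) : (X, y) ∈ Far g J := by
  rw [mem_far_iff]
  intro q hq
  exact le_ldist_of_le_fst (by have := hX q hq; push_cast; omega)

/-- A whole row more than `g` above or below `J` is far. [folklore] -/
theorem mem_far_of_snd {Y : ℤ} (hY : ∀ q ∈ J, (g : ℤ) < |Y - q.2|) (x : ℤ) : (x, Y) ∈ Far g J := by
  rw [mem_far_iff]
  intro q hq
  exact le_ldist_of_le_snd (by have := hY q hq; push_cast; omega)

/-- The bounding box of `J`: extreme coordinates. [folklore] -/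
def minFst (J : Finset (ℤ × ℤ)) (hJ : J.Nonempty) : ℤ := J.inf' hJ Prod.fst
/-- See `minFst`. [folklore] -/
def maxFst (J : Finset (ℤ × ℤ)) (hJ : J.Nonempty) : ℤ := J.sup' hJ Prod.fst
/-- See `minFst`. [folklore] -/
def minSnd (J : Finset (ℤ × ℤ)) (hJ : J.Nonempty) : ℤ := J.inf' hJ Prod.snd
/-- See `minFst`. [folklore] -/
def maxSnd (J : Finset (ℤ × ℤ)) (hJ : J.Nonempty) : ℤ := J.sup' hJ Prod.snd

/-- `minFst` is a lower bound. [folklore] -/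
theorem minFst_le (hJ : J.Nonempty) {q : ℤ × ℤ} (hq : q ∈ J) : minFst J hJ ≤ q.1 := Finset.inf'_le _ hq
/-- `maxFst` is an upper bound. [folklore] -/
theorem le_maxFst (hJ : J.Nonempty) {q : ℤ × ℤ} (hq : q ∈ J) : q.1 ≤ maxFst J hJ := Finset.le_sup' _ hq
/-- `minSnd` is a lower bound. [folklore] -/
theorem minSnd_le (hJ : J.Nonempty) {q : ℤ × ℤ} (hq : q ∈ J) : minSnd J hJ ≤ q.2 := Finset.inf'_le _ hq
/-- `maxSnd` is an upper bound. [folklore] -/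
theorem le_maxSnd (hJ : J.Nonempty) {q : ℤ × ℤ} (hq : q ∈ J) : q.2 ≤ maxSnd J hJ := Finset.le_sup' _ hq

/-- **A row above `J` is outer**: every site of a row `y = Y` with `Y > maxSnd + g` is joined,
walking left, to an escaping site. [folklore] -/
theorem mem_outer_of_row_above (hg : 1 ≤ g) (hJ : J.Nonempty) {Y : ℤ} (hY : maxSnd J hJ + g < Y)
    (x : ℤ) : (x, Y) ∈ Outer g J := by
  have hrow : ∀ x', (x', Y) ∈ Far g J := fun x' =>
    mem_far_of_snd (fun q hq => by have := le_maxSnd hJ hq; rw [abs_of_nonneg (by omega)]; omega) x'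
  -- walk left `K` steps to an escaping site
  set K : ℕ := (x - (minFst J hJ - g - 1)).toNat with hK
  have hwalk := reflTransGen_walk_fst (J := J) hg (x, Y) (-1) (Or.inr rfl) K
    (fun k _ => by simpa using hrow (x + k * (-1)))
  refine mem_outer_of_reflTransGen hwalk (Escapes.mem_outer ?_)
  intro q hq
  have h1 := minFst_le hJ hq
  have hK' : x - (minFst J hJ - g - 1) ≤ (K : ℤ) := Int.self_le_toNat _
  simp only
  linarith

/-- **Far sites on or beyond a side of the bounding box are outer.** If a far site is not
strictly inside the bounding box of `J` (its abscissa is `≤ min` or `≥ max`, or its ordinate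
is), then it is joined through far sites to an escaping site: walk away from `J`
perpendicularly to that side (the distance to `J` does not decrease), then along a far row to
the left. [cite: Hochman2025, §6.1 (components not separated from infinity)] -/
theorem mem_outer_of_not_inside (hg : 1 ≤ g) (hJ : J.Nonempty) {u : ℤ × ℤ} (hu : u ∈ Far g J)
    (h : u.1 ≤ minFst J hJ ∨ maxFst J hJ ≤ u.1 ∨ u.2 ≤ minSnd J hJ ∨ maxSnd J hJ ≤ u.2) :
    u ∈ Outer g J := by
  rw [mem_far_iff] at hu
  set Y := maxSnd J hJ + g + 1 with hY
  -- Step 1: from `u` reach a site `u₁` whose whole column or row is far, by a monotone walk.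
  -- Case analysis on the side.
  rcases h with h | h | h | h
  · -- left: walk left `g + 1` steps; then the column is far; then walk up to row `Y`; done.
    set K : ℕ := g + 1 with hK
    have hfar : ∀ k : ℕ, k ≤ K → (u.1 + k * (-1 : ℤ), u.2) ∈ Far g J := by
      intro k _
      rw [mem_far_iff]
      intro q hq
      have hq1 := minFst_le hJ hq
      have huq := hu q hq
      -- the first coordinate difference only grows
      simp only [ldist] at huq ⊢
      have e1 : (u.1 + k * (-1 : ℤ) - q.1).natAbs = (u.1 - q.1).natAbs + k := by omega
      rw [e1]
      omega
    have hw := reflTransGen_walk_fst (J := J) hg u (-1) (Or.inr rfl) K hfar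
    set u₁ : ℤ × ℤ := (u.1 + K * (-1 : ℤ), u.2) with hu₁
    -- the column of `u₁` is far
    have hcol : ∀ y, (u₁.1, y) ∈ Far g J := fun y =>
      mem_far_of_fst (fun q hq => by
        have := minFst_le hJ hq
        simp only [hu₁]
        rw [abs_of_nonpos (by omega)]
        omega) y
    -- walk up to a far row `Y'`
    set Y' : ℤ := max Y u.2 with hY'
    set L : ℕ := (Y' - u.2).toNat with hL
    have hYu : u.2 ≤ Y' := le_max_right _ _
    have hw2 := reflTransGen_walk_snd (J := J) hg u₁ 1 (Or.inl rfl) L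
      (fun k _ => by simpa using hcol (u₁.2 + k))
    have hLe : u₁.2 + (L : ℤ) * 1 = Y' := by
      simp only [hu₁, mul_one]
      rw [hL, Int.toNat_of_nonneg (by omega)]
      ring
    rw [hLe] at hw2
    refine mem_outer_of_reflTransGen (hw.trans hw2) (mem_outer_of_row_above hg hJ ?_ _)
    have : Y ≤ Y' := le_max_left _ _
    omega
  · -- right: walk right `g + 1` steps; column far; up to row `Y`.
    set K : ℕ := g + 1 with hK
    have hfar : ∀ k : ℕ, k ≤ K → (u.1 + k * (1 : ℤ), u.2) ∈ Far g J := by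
      intro k _
      rw [mem_far_iff]
      intro q hq
      have hq1 := le_maxFst hJ hq
      have huq := hu q hq
      simp only [ldist] at huq ⊢
      have e1 : (u.1 + k * (1 : ℤ) - q.1).natAbs = (u.1 - q.1).natAbs + k := by omega
      rw [e1]
      omega
    have hw := reflTransGen_walk_fst (J := J) hg u 1 (Or.inl rfl) K hfar
    set u₁ : ℤ × ℤ := (u.1 + K * (1 : ℤ), u.2) with hu₁
    have hcol : ∀ y, (u₁.1, y) ∈ Far g J := fun y =>
      mem_far_of_fst (fun q hq => by
        have := le_maxFst hJ hq
        simp only [hu₁]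
        rw [abs_of_nonneg (by omega)]
        omega) y
    set Y' : ℤ := max Y u.2 with hY'
    set L : ℕ := (Y' - u.2).toNat with hL
    have hYu : u.2 ≤ Y' := le_max_right _ _
    have hw2 := reflTransGen_walk_snd (J := J) hg u₁ 1 (Or.inl rfl) L
      (fun k _ => by simpa using hcol (u₁.2 + k))
    have hLe : u₁.2 + (L : ℤ) * 1 = Y' := by
      simp only [hu₁, mul_one]
      rw [hL, Int.toNat_of_nonneg (by omega)]
      ring
    rw [hLe] at hw2
    refine mem_outer_of_reflTransGen (hw.trans hw2) (mem_outer_of_row_above hg hJ ?_ _)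
    have : Y ≤ Y' := le_max_left _ _
    omega
  · -- bottom: walk down `g + 1` steps; the row is far; walk left to an escaping site.
    set K : ℕ := g + 1 with hK
    have hfar : ∀ k : ℕ, k ≤ K → (u.1, u.2 + k * (-1 : ℤ)) ∈ Far g J := by
      intro k _
      rw [mem_far_iff]
      intro q hq
      have hq1 := minSnd_le hJ hq
      have huq := hu q hq
      simp only [ldist] at huq ⊢
      have e1 : (u.2 + k * (-1 : ℤ) - q.2).natAbs = (u.2 - q.2).natAbs + k := by omega
      rw [e1]
      omega
    have hw := reflTransGen_walk_snd (J := J) hg u (-1) (Or.inr rfl) K hfar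
    set u₁ : ℤ × ℤ := (u.1, u.2 + K * (-1 : ℤ)) with hu₁
    have hrow : ∀ x, (x, u₁.2) ∈ Far g J := fun x =>
      mem_far_of_snd (fun q hq => by
        have := minSnd_le hJ hq
        simp only [hu₁]
        rw [abs_of_nonpos (by omega)]
        omega) x
    set L : ℕ := (u.1 - (minFst J hJ - g - 1)).toNat with hL
    have hw2 := reflTransGen_walk_fst (J := J) hg u₁ (-1) (Or.inr rfl) L
      (fun k _ => by simpa using hrow (u₁.1 + k * (-1)))
    refine mem_outer_of_reflTransGen (hw.trans hw2) (Escapes.mem_outer ?_)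
    intro q hq
    have h1 := minFst_le hJ hq
    have hL' : u.1 - (minFst J hJ - g - 1) ≤ (L : ℤ) := Int.self_le_toNat _
    simp only [hu₁]
    linarith
  · -- top: walk up `g + 1` steps; the row is far; walk left.
    set K : ℕ := g + 1 with hK
    have hfar : ∀ k : ℕ, k ≤ K → (u.1, u.2 + k * (1 : ℤ)) ∈ Far g J := by
      intro k _
      rw [mem_far_iff]
      intro q hq
      have hq1 := le_maxSnd hJ hq
      have huq := hu q hq
      simp only [ldist] at huq ⊢
      have e1 : (u.2 + k * (1 : ℤ) - q.2).natAbs = (u.2 - q.2).natAbs + k := by omega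
      rw [e1]
      omega
    have hw := reflTransGen_walk_snd (J := J) hg u 1 (Or.inl rfl) K hfar
    set u₁ : ℤ × ℤ := (u.1, u.2 + K * (1 : ℤ)) with hu₁
    have hrow : ∀ x, (x, u₁.2) ∈ Far g J := fun x =>
      mem_far_of_snd (fun q hq => by
        have := le_maxSnd hJ hq
        simp only [hu₁]
        rw [abs_of_nonneg (by omega)]
        omega) x
    set L : ℕ := (u.1 - (minFst J hJ - g - 1)).toNat with hL
    have hw2 := reflTransGen_walk_fst (J := J) hg u₁ (-1) (Or.inr rfl) L
      (fun k _ => by simpa using hrow (u₁.1 + k * (-1)))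
    refine mem_outer_of_reflTransGen (hw.trans hw2) (Escapes.mem_outer ?_)
    intro q hq
    have h1 := minFst_le hJ hq
    have hL' : u.1 - (minFst J hJ - g - 1) ≤ (L : ℤ) := Int.self_le_toNat _
    simp only [hu₁]
    linarith

/-- **Non-outer far sites lie strictly inside the bounding box.** [folklore] -/
theorem inside_of_not_mem_outer (hg : 1 ≤ g) (hJ : J.Nonempty) {u : ℤ × ℤ} (hu : u ∈ Far g J)
    (hno : u ∉ Outer g J) :
    minFst J hJ < u.1 ∧ u.1 < maxFst J hJ ∧ minSnd J hJ < u.2 ∧ u.2 < maxSnd J hJ := by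
  by_contra hcon
  apply hno
  apply mem_outer_of_not_inside hg hJ hu
  omega

/-- The complement of the outer region lies in the `g`-neighbourhood of the bounding box, so
it is finite. [folklore] -/
theorem finite_compl_outer (hg : 1 ≤ g) (hJ : J.Nonempty) : (Outer g J)ᶜ.Finite := by
  apply Set.Finite.subset (Set.finite_Icc (minFst J hJ - g, minSnd J hJ - g) (maxFst J hJ + g, maxSnd J hJ + g))
  intro u hu
  simp only [mem_compl_iff] at hu
  rw [Set.mem_Icc, Prod.le_def, Prod.le_def]
  simp only
  by_contra hout
  apply hu
  -- `u` is outside the enlarged box in some direction, hence far and not inside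
  have hfar : u ∈ Far g J := by
    rw [mem_far_iff]
    intro q hq
    have h1 := minFst_le hJ hq; have h2 := le_maxFst hJ hq
    have h3 := minSnd_le hJ hq; have h4 := le_maxSnd hJ hq
    rcases not_and_or.mp hout with h | h <;> rw [not_and_or, not_le, not_le] at h
    · rcases h with h | h
      · exact le_ldist_of_le_fst (by rw [abs_of_nonpos (by omega)]; push_cast; omega)
      · exact le_ldist_of_le_snd (by rw [abs_of_nonpos (by omega)]; push_cast; omega)
    · rcases h with h | h
      · exact le_ldist_of_le_fst (by rw [abs_of_nonneg (by omega)]; push_cast; omega)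
      · exact le_ldist_of_le_snd (by rw [abs_of_nonneg (by omega)]; push_cast; omega)
  apply mem_outer_of_not_inside hg hJ hfar
  obtain ⟨q, hq⟩ := hJ
  have h1 := minFst_le ⟨q, hq⟩ hq; have h2 := le_maxFst ⟨q, hq⟩ hq
  have h3 := minSnd_le ⟨q, hq⟩ hq; have h4 := le_maxSnd ⟨q, hq⟩ hq
  omega

/-- Sites of `J` are not far. [folklore] -/
theorem not_mem_far_of_mem {q : ℤ × ℤ} (hq : q ∈ J) : q ∉ Far g J := by
  intro h
  have := mem_far_iff.mp h q hq
  simp at this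

/-- Sites of `J` are not outer. [folklore] -/
theorem not_mem_outer_of_mem {q : ℤ × ℤ} (hq : q ∈ J) : q ∉ Outer g J :=
  fun h => not_mem_far_of_mem hq (outer_subset_far h)

/-! ### Sup-diameter of a finite set of sites -/

/-- The sup-diameter of a finite set of sites (`0` if empty). [folklore] -/
def ldiam (S : Finset (ℤ × ℤ)) : ℕ := S.sup fun p => S.sup fun q => ldist p q

/-- Distances inside a set are bounded by its diameter. [folklore] -/
theorem ldist_le_ldiam {S : Finset (ℤ × ℤ)} {p q : ℤ × ℤ} (hp : p ∈ S) (hq : q ∈ S) :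
    ldist p q ≤ ldiam S :=
  le_trans (Finset.le_sup (f := fun q => ldist p q) hq) (Finset.le_sup (f := fun p => S.sup fun q => ldist p q) hp)

/-- The diameter is the least bound on distances. [folklore] -/
theorem ldiam_le_iff {S : Finset (ℤ × ℤ)} {D : ℕ} : ldiam S ≤ D ↔ ∀ p ∈ S, ∀ q ∈ S, ldist p q ≤ D := by
  simp only [ldiam, Finset.sup_le_iff]

/-- **A non-empty set of far sites missing the outer region has diameter `≤ diam J - 2`**
(it lies strictly inside the bounding box). [cite: Hochman2025, §6.1] -/
theorem ldiam_add_two_le (hg : 1 ≤ g) (hJ : J.Nonempty) {K : Finset (ℤ × ℤ)} (hK : K.Nonempty)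
    (hfar : (↑K : Set (ℤ × ℤ)) ⊆ Far g J) (hout : Disjoint (↑K : Set (ℤ × ℤ)) (Outer g J)) :
    ldiam K + 2 ≤ ldiam J := by
  have hins : ∀ u ∈ K, minFst J hJ < u.1 ∧ u.1 < maxFst J hJ ∧ minSnd J hJ < u.2 ∧ u.2 < maxSnd J hJ :=
    fun u hu => inside_of_not_mem_outer hg hJ (hfar hu) (Set.disjoint_left.mp hout hu)
  -- the bounding box of `J` has sides `≤ ldiam J`
  obtain ⟨qa, hqa, hqa'⟩ := Finset.exists_mem_eq_inf' hJ Prod.fst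
  obtain ⟨qb, hqb, hqb'⟩ := Finset.exists_mem_eq_sup' hJ Prod.fst
  obtain ⟨qc, hqc, hqc'⟩ := Finset.exists_mem_eq_inf' hJ Prod.snd
  obtain ⟨qd, hqd, hqd'⟩ := Finset.exists_mem_eq_sup' hJ Prod.snd
  have hx : maxFst J hJ - minFst J hJ ≤ ldiam J := by
    have h1 := (abs_sub_le_ldist qb qa).1
    have h2 : (ldist qb qa : ℤ) ≤ ldiam J := by exact_mod_cast ldist_le_ldiam hqb hqa
    change J.sup' hJ Prod.fst - J.inf' hJ Prod.fst ≤ _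
    rw [hqa', hqb']
    linarith [le_abs_self (qb.1 - qa.1)]
  have hy : maxSnd J hJ - minSnd J hJ ≤ ldiam J := by
    have h1 := (abs_sub_le_ldist qd qc).2
    have h2 : (ldist qd qc : ℤ) ≤ ldiam J := by exact_mod_cast ldist_le_ldiam hqd hqc
    change J.sup' hJ Prod.snd - J.inf' hJ Prod.snd ≤ _
    rw [hqc', hqd']
    linarith [le_abs_self (qd.2 - qc.2)]
  obtain ⟨u₀, hu₀⟩ := hK
  have h0 := hins u₀ hu₀
  have hD : 2 ≤ ldiam J := by
    have : (2 : ℤ) ≤ ldiam J := by linarith [h0.1, h0.2.1]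
    exact_mod_cast this
  suffices ldiam K ≤ ldiam J - 2 by omega
  rw [ldiam_le_iff]
  intro p hp q hq
  have hp' := hins p hp
  have hq' := hins q hq
  rw [ldist_le_iff]
  push_cast [Nat.cast_sub hD]
  constructor <;> rw [abs_le] <;> constructor <;> linarith [hp'.1, hp'.2.1, hq'.1, hq'.2.1, hp'.2.2.1,
    hp'.2.2.2, hq'.2.2.1, hq'.2.2.2]

/-! ### §6.1: strong irreducibility from gluing into the outer far region -/

section Reduction

variable {A : Type*} {X : Set (ℤ × ℤ → A)}

/-- The component of `p` in the finite set `S` for the `g`-chain relation. [folklore] -/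
private noncomputable def comp (g : ℕ) (S : Finset (ℤ × ℤ)) (p : ℤ × ℤ) : Finset (ℤ × ℤ) := by
  classical
  exact S.filter fun q => Relation.ReflTransGen (ChainRel g (↑S : Set (ℤ × ℤ))) p q

/-- Membership in a component. [folklore] -/
private theorem mem_comp {S : Finset (ℤ × ℤ)} {p q : ℤ × ℤ} :
    q ∈ comp g S p ↔ q ∈ S ∧ Relation.ReflTransGen (ChainRel g (↑S : Set (ℤ × ℤ))) p q := by
  classical
  simp [comp]

/-- Components are subsets. [folklore] -/
private theorem comp_subset {S : Finset (ℤ × ℤ)} {p : ℤ × ℤ} : comp g S p ⊆ S := by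
  classical
  exact Finset.filter_subset _ _

/-- A site is in its own component. [folklore] -/
private theorem self_mem_comp {S : Finset (ℤ × ℤ)} {p : ℤ × ℤ} (hp : p ∈ S) : p ∈ comp g S p :=
  mem_comp.mpr ⟨hp, Relation.ReflTransGen.refl⟩

/-- A chain in `S` from `p` stays in the component of `p`, so it is a chain of the component.
[folklore] -/
private theorem chain_restrict_comp {S : Finset (ℤ × ℤ)} {p q : ℤ × ℤ}
    (hq : Relation.ReflTransGen (ChainRel g (↑S : Set (ℤ × ℤ))) p q) :
    Relation.ReflTransGen (ChainRel g (↑(comp g S p) : Set (ℤ × ℤ))) p q := by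
  induction hq with
  | refl => exact Relation.ReflTransGen.refl
  | tail hab hbc ih =>
    refine Relation.ReflTransGen.tail ih ⟨?_, ?_, hbc.2.2⟩
    · exact Finset.mem_coe.mpr (mem_comp.mpr ⟨hbc.1, hab⟩)
    · exact Finset.mem_coe.mpr (mem_comp.mpr ⟨hbc.2.1, hab.tail hbc⟩)

/-- Components are chain-connected. [folklore] -/
private theorem comp_chainConnected {S : Finset (ℤ × ℤ)} {p : ℤ × ℤ} :
    ∀ a ∈ comp g S p, ∀ b ∈ comp g S p,
      Relation.ReflTransGen (ChainRel g (↑(comp g S p) : Set (ℤ × ℤ))) a b := by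
  intro a ha b hb
  have ha' := chain_restrict_comp (mem_comp.mp ha).2
  have hb' := chain_restrict_comp (mem_comp.mp hb).2
  exact (chainRel_reflTransGen_symm ha').trans hb'

/-- Sites of `S` outside the component of `p` are far from it. [folklore] -/
private theorem far_of_not_mem_comp {S : Finset (ℤ × ℤ)} {p q : ℤ × ℤ} (hq : q ∈ S)
    (hqn : q ∉ comp g S p) : q ∈ Far g (comp g S p) := by
  intro j hj
  by_contra hle
  push Not at hle
  have hj' := mem_comp.mp hj
  exact hqn (mem_comp.mpr ⟨hq, hj'.2.tail ⟨hj'.1, hq, by rwa [dist_comm]⟩⟩)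

/-- Components are equal or disjoint: if the component of `q` meets that of `p`, then `q` is in
the component of `p`. [folklore] -/
private theorem mem_comp_of_mem_comp_of_mem_comp {S : Finset (ℤ × ℤ)} {p q a : ℤ × ℤ}
    (ha : a ∈ comp g S q) (ha' : a ∈ comp g S p) : q ∈ comp g S p := by
  have h1 := (mem_comp.mp ha).2
  have h2 := (mem_comp.mp ha').2
  have hqS : q ∈ S := mem_of_reflTransGen h1 (mem_comp.mp ha).1
  exact mem_comp.mpr ⟨hqS, h2.trans (chainRel_reflTransGen_symm h1)⟩

/-- A chain with steps `≤ g` cannot leave `E` when everything outside `E` in `S = E ∪ F` is at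
distance `> g` from `E`. [folklore] -/
private theorem mem_of_chain_sep {E F : Finset (ℤ × ℤ)} (hEF : ∀ p ∈ E, ∀ q ∈ F, (g : ℝ) < dist p q)
    {p q : ℤ × ℤ} (hp : p ∈ E)
    (h : Relation.ReflTransGen (ChainRel g (↑(E ∪ F) : Set (ℤ × ℤ))) p q) : q ∈ E := by
  induction h with
  | refl => exact hp
  | tail _ hbc ih =>
    have hc : _ ∈ E ∪ F := Finset.mem_coe.mp hbc.2.1
    rcases Finset.mem_union.mp hc with hc | hc
    · exact hc
    · exact absurd hbc.2.2 (not_le.mpr (hEF _ ih _ hc))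

/-- **Hochman 2025, §6.1 — strong irreducibility from gluing into the outer far region.** If for
every finite non-empty `g`-chain-connected `J ⊆ ℤ²` and all `x, y ∈ X` there is `z ∈ X` with
`z = x` on `Outer g J` and `z = y` on `J`, then `X` admits gluing along every pair of finite
sets `E, F` with `d(E, F) > g` (property (B) of §6.1, the tree's
`IsFinitelyStronglyIrreducible X g`). The proof is the induction of §6.1 (C) ⇒ (D) over the
chain component of `E ∪ F` of minimal diameter, all other components lying in its outer region
(`ldiam_add_two_le`). [cite: Hochman2025, §6.1 ((B) ⇐ (C) ⇐ (D) ⇐ (E))] -/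
theorem _root_.Literature.Dynamics.SymbolicDynamics.isFinitelyStronglyIrreducible_of_outer
    {g : ℕ} (hg : 1 ≤ g)
    (h : ∀ J : Finset (ℤ × ℤ), J.Nonempty →
      (∀ p ∈ J, ∀ q ∈ J, Relation.ReflTransGen (ChainRel g (↑J : Set (ℤ × ℤ))) p q) →
        AdmitsGluing X (Outer g J) (↑J : Set (ℤ × ℤ))) :
    IsFinitelyStronglyIrreducible X g := by
  classical
  -- induction on `|E ∪ F|`
  suffices key : ∀ n : ℕ, ∀ E F : Finset (ℤ × ℤ), (E ∪ F).card ≤ n →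
      (∀ p ∈ E, ∀ q ∈ F, (g : ℝ) < dist p q) → AdmitsGluing X (↑E : Set (ℤ × ℤ)) ↑F from
    fun E F hEF => key _ E F le_rfl hEF
  intro n
  induction n with
  | zero =>
    intro E F hcard _ x hx y _
    have hE : E = ∅ := by
      have : (E ∪ F) = ∅ := Finset.card_eq_zero.mp (Nat.le_zero.mp hcard)
      exact Finset.union_eq_empty.mp this |>.1
    subst hE
    have hF : F = ∅ := by
      have : (∅ ∪ F : Finset (ℤ × ℤ)) = ∅ := Finset.card_eq_zero.mp (Nat.le_zero.mp hcard)
      simpa using this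
    subst hF
    exact ⟨x, hx, by simp, by simp⟩
  | succ n ih =>
    intro E F hcard hEF
    -- trivial cases
    by_cases hE : E = ∅
    · subst hE
      intro x _ y hy
      exact ⟨y, hy, by simp, fun _ _ => rfl⟩
    by_cases hF : F = ∅
    · subst hF
      intro x hx y _
      exact ⟨x, hx, fun _ _ => rfl, by simp⟩
    -- the component of minimal diameter
    set S : Finset (ℤ × ℤ) := E ∪ F with hS
    have hSne : S.Nonempty := by
      obtain ⟨p, hp⟩ := Finset.nonempty_iff_ne_empty.mpr hE
      exact ⟨p, Finset.mem_union_left _ hp⟩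
    obtain ⟨p₀, hp₀S, hmin⟩ := Finset.exists_min_image S (fun p => ldiam (comp g S p)) hSne
    set Jm := comp g S p₀ with hJm
    have hJmS : Jm ⊆ S := comp_subset
    have hp₀Jm : p₀ ∈ Jm := self_mem_comp hp₀S
    have hJmne : Jm.Nonempty := ⟨p₀, hp₀Jm⟩
    have hJmconn := comp_chainConnected (g := g) (S := S) (p := p₀)
    -- every site of `S` outside `Jm` is in `Outer g Jm`
    have hout : ∀ q ∈ S, q ∉ Jm → q ∈ Outer g Jm := by
      intro q hqS hqJ
      set Kq := comp g S q with hKq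
      have hKfar : (↑Kq : Set (ℤ × ℤ)) ⊆ Far g Jm := by
        intro a ha
        have ha' : a ∈ Kq := Finset.mem_coe.mp ha
        refine far_of_not_mem_comp (comp_subset ha') fun haJ => ?_
        exact hqJ (mem_comp_of_mem_comp_of_mem_comp ha' haJ)
      -- `Kq` is chain-connected inside `Far g Jm`
      have hKch : ∀ a ∈ Kq, Relation.ReflTransGen (ChainRel g (Far g Jm)) q a := by
        intro a ha
        exact reflTransGen_mono hKfar (chain_restrict_comp (mem_comp.mp ha).2)
      by_contra hqo
      -- then `Kq` misses `Outer`, so it is smaller than `Jm`: contradiction with minimality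
      have hdisj : Disjoint (↑Kq : Set (ℤ × ℤ)) (Outer g Jm) := by
        rw [Set.disjoint_left]
        intro a ha hao
        exact hqo (mem_outer_of_reflTransGen (hKch a (Finset.mem_coe.mp ha)) hao)
      have hlt : ldiam (comp g S q) + 2 ≤ ldiam Jm :=
        ldiam_add_two_le hg hJmne ⟨q, self_mem_comp hqS⟩ hKfar hdisj
      have hle : ldiam Jm ≤ ldiam (comp g S q) := hmin q hqS
      omega
    -- `Jm ⊆ E` or `Jm ⊆ F`
    have hcore := h Jm hJmne hJmconn
    rcases Finset.mem_union.mp hp₀S with hp₀E | hp₀F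
    · -- `Jm ⊆ E`: glue `E \ Jm, F` first, then `Jm` (with `x`)
      have hJmE : Jm ⊆ E := fun q hq => mem_of_chain_sep hEF hp₀E (mem_comp.mp hq).2
      set E' := E \ Jm with hE'
      have hcard' : (E' ∪ F).card ≤ n := by
        have hsub : E' ∪ F ⊆ S := Finset.union_subset_union Finset.sdiff_subset le_rfl
        have hne : E' ∪ F ≠ S := by
          intro heq
          have : p₀ ∈ E' ∪ F := heq ▸ hp₀S
          rcases Finset.mem_union.mp this with h1 | h1
          · exact (Finset.mem_sdiff.mp h1).2 hp₀Jm
          · exact absurd (hEF p₀ hp₀E p₀ h1) (by simp)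
        have := Finset.card_lt_card (Finset.ssubset_iff_subset_ne.mpr ⟨hsub, hne⟩)
        omega
      have hEF' : ∀ p ∈ E', ∀ q ∈ F, (g : ℝ) < dist p q :=
        fun p hp q hq => hEF p (Finset.sdiff_subset hp) q hq
      intro x hx y hy
      obtain ⟨z₁, hz₁, hz₁x, hz₁y⟩ := ih E' F hcard' hEF' x hx y hy
      obtain ⟨z, hz, hzz₁, hzx⟩ := hcore z₁ hz₁ x hx
      refine ⟨z, hz, fun u hu => ?_, fun q hq => ?_⟩
      · by_cases huJ : u ∈ Jm
        · exact hzx huJ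
        · rw [hzz₁ (hout u (Finset.mem_union_left _ hu) huJ)]
          exact hz₁x (show u ∈ (↑E' : Set (ℤ × ℤ)) from Finset.mem_sdiff.mpr ⟨hu, huJ⟩)
      · have hqJ : q ∉ Jm := fun hqJ => absurd (hEF q (hJmE hqJ) q hq) (by simp)
        rw [hzz₁ (hout q (Finset.mem_union_right _ hq) hqJ)]
        exact hz₁y hq
    · -- `Jm ⊆ F`: glue `E, F \ Jm` first, then `Jm` (with `y`)
      have hJmF : Jm ⊆ F := by
        intro q hq
        have hch := (mem_comp.mp hq).2
        -- chains from a point of `F` stay in `F` (swap the roles of `E`, `F`)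
        have hFE : ∀ p ∈ F, ∀ q ∈ E, (g : ℝ) < dist p q :=
          fun p hp q hq => by rw [dist_comm]; exact hEF q hq p hp
        have hch' : Relation.ReflTransGen (ChainRel g (↑(F ∪ E) : Set (ℤ × ℤ))) p₀ q := by
          rw [Finset.union_comm]; exact hch
        exact mem_of_chain_sep hFE hp₀F hch'
      set F' := F \ Jm with hF'
      have hcard' : (E ∪ F').card ≤ n := by
        have hsub : E ∪ F' ⊆ S := Finset.union_subset_union le_rfl Finset.sdiff_subset
        have hne : E ∪ F' ≠ S := by
          intro heq
          have : p₀ ∈ E ∪ F' := heq ▸ hp₀S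
          rcases Finset.mem_union.mp this with h1 | h1
          · exact absurd (hEF p₀ h1 p₀ hp₀F) (by simp)
          · exact (Finset.mem_sdiff.mp h1).2 hp₀Jm
        have := Finset.card_lt_card (Finset.ssubset_iff_subset_ne.mpr ⟨hsub, hne⟩)
        omega
      have hEF' : ∀ p ∈ E, ∀ q ∈ F', (g : ℝ) < dist p q :=
        fun p hp q hq => hEF p hp q (Finset.sdiff_subset hq)
      intro x hx y hy
      obtain ⟨z₁, hz₁, hz₁x, hz₁y⟩ := ih E F' hcard' hEF' x hx y hy
      obtain ⟨z, hz, hzz₁, hzy⟩ := hcore z₁ hz₁ y hy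
      refine ⟨z, hz, fun u hu => ?_, fun q hq => ?_⟩
      · have huJ : u ∉ Jm := fun huJ => absurd (hEF u hu u (hJmF huJ)) (by simp)
        rw [hzz₁ (hout u (Finset.mem_union_left _ hu) huJ)]
        exact hz₁x hu
      · by_cases hqJ : q ∈ Jm
        · exact hzy hqJ
        · rw [hzz₁ (hout q (Finset.mem_union_right _ hq) hqJ)]
          exact hz₁y (show q ∈ (↑F' : Set (ℤ × ℤ)) from Finset.mem_sdiff.mpr ⟨hq, hqJ⟩)

end Reduction

end Hochman2025

end Literature.Dynamics.SymbolicDynamics
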